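import Mathlib

/-!
# Route «KPlusLogSqLaw», crux `WeakLifting` (stmt-ValiantsHypothesis-19561) — α row, RESOLVED limit:
# META NO-GO in the kernel — no memoryless potential on matchings proves the parity-layer law `D_{Λ2}` (explicit `m = 6` certificate; g17)

HONEST FRAMING.  Helper / negative-knowledge lemma (`--supports stmt-ValiantsHypothesis-19561 --as helper`), seat pub-symmetroid-conjb-2 (g17), cell
`pub-symmetroid`, 2026-08-28.  Elementary and decidable; def-free; resolved (tropical) limit only; it constrains PROOF METHODS for the open law `D_{Λ2}`
(THEORY-NOTE-g17 §4) and says nothing about `WeakLifting` / `TropicalB` in their windows, Conjecture B (`KPlusLogSqLaw`), `MatrixDescartes` or VP ≠ VNP.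

CONTENT (paper: HOME/pub-symmetroid-conjb-2/g17/theory/THEORY-NOTE-g17.md §4.8(b)).  Path with `N = 5` edges `0,…,4` (the α row at `m = 6`), edge word
`λ = (−2, 2, 1, −1, 1)`, matchings = subsets of `range 5` without consecutive elements, slope `Σ_{e∈μ} λ_e`.  A «potential proof» of `D_{Λ2}` («an upper
envelope has at most `N` parity-changing breakpoints») would be a function `Ψ` on matchings that (i) rises by at least `1` across every parity-changing
generic breakpoint exchange and does not drop across the others, and (ii) has range at most `N = 5`.  A breakpoint exchange at time `0` of the envelope
`t ↦ max_ν (Σ_{e∈ν} a_e + t·slope ν)` is a pair `μ ≠ μ'` of matchings with `slope μ < slope μ'` that are the ONLY two maximisers of `Σ_{e∈ν} a_e`.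
`no_state_potential_m6` : no such `Ψ` exists — six explicit integer intercept vectors `a` realise the parity-changing exchanges
`{0,3}→{0}→{0,2}→{0,2,4}→{1,3}→{1}→{1,4}` (all at time `0`, each with exactly two maximisers, checked by `decide`), so (i) forces `Ψ{1,4} − Ψ{0,3} ≥ 6`,
contradicting (ii).  No single envelope passes through all seven matchings (the block `{3}` would be exchanged twice), which is why the law itself survives:
any proof must carry memory of the blocks already exchanged (THEORY-NOTE-g17 §4.8(e)–(g)).  [this seat; elementary]
-/

-- `Summit.ValiantsHypothesis.ValiantsHypothesis.…` repeats a component by the D-0017 layout (single-conjunct summit); the name is mandated.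
set_option linter.dupNamespace false

namespace Summit.ValiantsHypothesis.ValiantsHypothesis.Theorems.KPlusLogSqLaw.ResolvedNoStatePotential

open Finset

/-- META NO-GO (`m = 6`, word `λ = (−2,2,1,−1,1)` written as the list `W`).  There is no `Ψ : Finset ℕ → ℤ` such that
(i) for every integer intercept list `a` and every pair of matchings `μ ≠ μ'` in `range 5` with `slope μ < slope μ'` that are exactly the two
maximisers of `ν ↦ Σ_{e∈ν} a_e` over matchings (a generic breakpoint exchange at time `0`), `Ψ μ' − Ψ μ ≥ |μ ∆ μ'| mod 2`; and
(ii) `Ψ ν − Ψ μ ≤ 5` for all matchings `μ, ν`. -/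
theorem no_state_potential_m6 :
    ¬ ∃ Ψ : Finset ℕ → ℤ,
      (∀ (a : List ℤ) (μ μ' : Finset ℕ),
          μ ∈ (range 5).powerset → (∀ i ∈ μ, i + 1 ∉ μ) →
          μ' ∈ (range 5).powerset → (∀ i ∈ μ', i + 1 ∉ μ') → μ ≠ μ' →
          (∑ e ∈ μ, ([-2, 2, 1, -1, 1] : List ℤ).getD e 0) < ∑ e ∈ μ', ([-2, 2, 1, -1, 1] : List ℤ).getD e 0 →
          (∀ ν ∈ (range 5).powerset, (∀ i ∈ ν, i + 1 ∉ ν) →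
              (∑ e ∈ ν, a.getD e 0) ≤ (∑ e ∈ μ, a.getD e 0) ∧
              ((∑ e ∈ ν, a.getD e 0) = (∑ e ∈ μ, a.getD e 0) → ν = μ ∨ ν = μ')) →
          ((((μ \ μ') ∪ (μ' \ μ)).card % 2 : ℕ) : ℤ) ≤ Ψ μ' - Ψ μ) ∧
      (∀ μ ν : Finset ℕ, μ ∈ (range 5).powerset → (∀ i ∈ μ, i + 1 ∉ μ) →
          ν ∈ (range 5).powerset → (∀ i ∈ ν, i + 1 ∉ ν) → Ψ ν - Ψ μ ≤ 5) := by
  rintro ⟨Ψ, hstep, hrange⟩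
  -- the six realised parity-changing exchanges (intercepts a, all at time 0)
  have h1 := hstep [1, 0, -1, 0, -1] {0, 3} {0} (by decide) (by decide) (by decide) (by decide) (by decide) (by decide) (by decide)
  have h2 := hstep [1, 0, 0, -1, -1] {0} {0, 2} (by decide) (by decide) (by decide) (by decide) (by decide) (by decide) (by decide)
  have h3 := hstep [1, 0, 1, 0, 0] {0, 2} {0, 2, 4} (by decide) (by decide) (by decide) (by decide) (by decide) (by decide) (by decide)
  have h4 := hstep [1, 2, 2, 2, 1] {0, 2, 4} {1, 3} (by decide) (by decide) (by decide) (by decide) (by decide) (by decide) (by decide)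
  have h5 := hstep [0, 1, 0, 0, -1] {1, 3} {1} (by decide) (by decide) (by decide) (by decide) (by decide) (by decide) (by decide)
  have h6 := hstep [0, 1, 0, -1, 0] {1} {1, 4} (by decide) (by decide) (by decide) (by decide) (by decide) (by decide) (by decide)
  have e1 : ((((({0, 3} : Finset ℕ) \ {0}) ∪ ({0} \ {0, 3})).card % 2 : ℕ) : ℤ) = 1 := by decide
  have e2 : ((((({0} : Finset ℕ) \ {0, 2}) ∪ ({0, 2} \ {0})).card % 2 : ℕ) : ℤ) = 1 := by decide
  have e3 : ((((({0, 2} : Finset ℕ) \ {0, 2, 4}) ∪ ({0, 2, 4} \ {0, 2})).card % 2 : ℕ) : ℤ) = 1 := by decide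
  have e4 : ((((({0, 2, 4} : Finset ℕ) \ {1, 3}) ∪ ({1, 3} \ {0, 2, 4})).card % 2 : ℕ) : ℤ) = 1 := by decide
  have e5 : ((((({1, 3} : Finset ℕ) \ {1}) ∪ ({1} \ {1, 3})).card % 2 : ℕ) : ℤ) = 1 := by decide
  have e6 : ((((({1} : Finset ℕ) \ {1, 4}) ∪ ({1, 4} \ {1})).card % 2 : ℕ) : ℤ) = 1 := by decide
  rw [e1] at h1; rw [e2] at h2; rw [e3] at h3; rw [e4] at h4; rw [e5] at h5; rw [e6] at h6
  have hr := hrange {0, 3} {1, 4} (by decide) (by decide) (by decide) (by decide)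
  linarith

end Summit.ValiantsHypothesis.ValiantsHypothesis.Theorems.KPlusLogSqLaw.ResolvedNoStatePotential
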